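import Literature.MathematicalPhysics.QuantumFieldTheory.Balaban1983to89.B9RWSumsAllBlocksPair
import Literature.MathematicalPhysics.QuantumFieldTheory.Balaban1983to89.B9RWSumsCompleteGeo9YNbr
import Literature.MathematicalPhysics.QuantumFieldTheory.Balaban1983to89.B9RWSumsCompleteGeo9Y

/-!
# `Balaban1983to89.B9RWSumsCompleteGeo9YPair` — rows 13 ∕ 18 ∕ 19 of the N06 census AT THE GEOMETRY OF RECORD, neighbourhood-sited
# co-readings AND the printed second-order L² members (3.46)₃,₅ as DIRECTION-PAIR FAMILIES: Theorem 3.7 ∧ Corollary 3.8 and Theorem 3.10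
# at the literal all-blocks pins, composed from the operator-level inputs alone (the `Pair` twins of `B9RWSumsCompleteGeo9YNbr`)

T. Bałaban, *Propagators for lattice gauge theories in a background field*, Commun. Math. Phys. **99** (1985) 389–434
[`Balaban1985BackgroundPropagators`, "B9"], Thm 3.7 (3.90) p. 409, Cor. 3.8 (3.94) p. 410, Thm 3.10 (3.107)–(3.108) pp. 415–416,
(3.42)–(3.47) pp. 397–398 (p. 397: Δ̃(y)); [4] = T. Bałaban, *Propagators and renormalization transformations for lattice gauge
theories. II*, Commun. Math. Phys. **96** (1984) 223–250 [`Balaban1984PropagatorsII`], Lemma 2.1 (2.59)–(2.61) pp. 233–234, (2.2) p. 224,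
(2.51)–(2.52) p. 232.

statement-level skeleton of published theorems with citation tags; proofs where landed; nothing here is a claim about the
Yang–Mills mass gap

WHY THIS FILE.  `B9RWSumsCompleteGeo9YRel.thm37_cor38_complete_geo9Y_rel` ∕ `thm310_complete_geo9Y_rel` compose the all-blocks `Rel` leaves at
def-Y's members `geo9Y` — but their (3.43)–(3.46) co-reading binders `L2ReadsRel` ∕ `H1ReadsRel` ∕ `InputReadsRel` observe the class of y while
`(geo9Y x).cutIn = cutInT` is the Δ̃-reading, and n06-d's coordinate evaluation over-counts the fibre-L² size (`B9RWSumsReadsRelNegative`).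
Here the SAME compositions on `B9RWSumsAllBlocksPair.thm37Printed_allPin_completePair` ∕ `thm310Printed_allPin_completePair` (the L² lines
n = 4, 5 — def-Y's K-index order, v3.1 of the leaves — modelled by the printed pair families ∇_ν∇_μG, G∇*_ν∇*_μ packaged by `familyOp`, the
mixed line n = 3 on the one-slot model `D ∘ₗ (G ∘ₗ Dstar)`, letters `DirOps37`∕`DirOps310`) at observation
radius `r := 2` with EVERY new geometric binder of the neighbourhood engines DISCHARGED BY NAME at the record: the triangle inequality and
symmetry of d (`geo9Y_dist_triangle`, `geo9Y_dist_symm`), and the level comparability `d(a,a′) ≤ 2 ⇒ Lʲ⁽ᵃ⁾η ≤ L·Lʲ⁽ᵃ′⁾η` (§0, from the level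
gap (2.60) in geometric form `levelGap_geo9K_one` and `M = L·M_h ≥ 8`).  What remains displayed about the readings: one block equivalence
`Rel x` per member with class multiplicity ≦ m and saturation, the neighbourhood count `(nbr (geo9Y x) 2 y).card ≤ mN`, the evaluation
constant `Cev ≥ 0`, and the sign `0 ≤ δ₁` of the all-blocks rate; the multiplicities enter the relations of the all-blocks constants
(mN·m·Cev·L²·e^{2δ₁}·C·L ≦ B₁, …, m·L·e^{2δ₁}·holderConst(β) ≦ Bβ(β), e^{2δ₁}·inputConst44 ≦ Bε, L·e^{2δ₁}·inputConst45 ≦ Bεβ).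

* (§0 of `B9RWSumsCompleteGeo9YNbr` by name: `len_le_of_dist_le_two_geo9Y`, `one_le_L_nat`.)
* ★★ `thm37_cor38_complete_geo9Y_pair` — rows 13 ∕ 19 (G′ side): `B9.Thm37Printed ∧ B9.Cor38Printed` at the literal all-blocks datum.
* ★★ `thm310_complete_geo9Y_pair` — rows 18 ∕ 19 (G side): `B9.Thm310Printed` at the literal all-blocks pin.

HONEST SCOPE.  Kernel bookkeeping (two compositions and one geometric lemma); nothing of [B9] or [4] asserted; every remaining hypothesis is
operator-level (posited schemas of printed shape), a co-reading schema, a letter, a count, or a sign ∕ relation of constants.  NOT a node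
discharge; count-neutral; one finite 𝕋^{d+1} programme at fixed ε — nothing continuum, nothing about the mass gap.  Cell `pub-ymgap` (HUMAN
RULING D-0062), Track A node N06 [B9], N06-ASSIGNMENT v1 bundle F6 (rows 18–19), seat `pub-ymgap-dag-n06-k` (gen 8), 2026-08-27 (second file of the session's pair-family line).
-/
namespace Literature.MathematicalPhysics.QuantumFieldTheory.Balaban1983to89.B9RWSumsCompleteGeo9YPair

open Literature.MathematicalPhysics.QuantumFieldTheory.Balaban1983to89
open Finset B6RandomWalk B9Thm34Ext B9Thm37Whole B9Cor38Whole B9Thm310Whole B9RowSum261Faces B9RowSum261DefiniteFaces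
open B9Ineq349Whole B9RWSums343to347Whole B9PinMembersKLevelV1 B9GeoLemma21KLevelV1 B9RWSums347DefiniteFaces
open B9Thm37GlueCor36 B9Thm37Glue B9RWSums346Schur B9RWSums343Holder B9RWSums343HolderGp B9RWSums346Lap B9RWSums344Input
open B9RWSums344InputGp B9RWSums346Two B9RWSums346TwoGp B11SectG B9CoRealizesRel B9RWSumsReadsRel B9RWSumsReadsNbr
open B9RWSumsAllBlocksNbr B9Ineq349Whole B9RWSums346SecondDiff B9RWSums346SecondDiffGp B9RWSumsAllBlocksPair
open B9RWSumsCompleteGeo9YNbr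
open Literature.MathematicalPhysics.QuantumFieldTheory.Balaban1983to89.B9RWSumsCompleteGeo9Y (const37_nonneg_of_signs)

noncomputable section

variable {d ℓ : ℕ} {hd : 1 ≤ d + 1} {hL : Odd (ℓ + 1) ∧ 1 < ℓ + 1} {b₀ b₁ : ℝ} {Mstar : ℕ}
variable [∀ x : MemberY d ℓ hd hL b₀ b₁ Mstar, Fintype (geo9Y x).Site]
  [∀ x : MemberY d ℓ hd hL b₀ b₁ Mstar, DecidableEq (geo9Y x).Site]
variable {c35 : ℝ} {bg : MemberY d ℓ hd hL b₀ b₁ Mstar → B9.Backgrounds}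


/-! ## Rows 13 ∕ 19, G′ side: Theorem 3.7 ∧ Corollary 3.8 at the literal all-blocks datum over the geometry of record -/

/-- ★★ **THEOREM 3.7 ∧ COROLLARY 3.8 AT THE LITERAL ALL-BLOCKS DATUM OVER def-Y's MEMBERS, FROM OPERATOR-LEVEL INPUTS ONLY, THE (3.43)–(3.46) CO-READINGS SITED ON THE NEIGHBOURHOOD OF RADIUS 2** (the `Nbr` form of `B9RWSumsCompleteGeo9YRel.thm37_cor38_complete_geo9Y_rel`, on `B9RWSumsAllBlocksNbr.thm37Printed_allPin_completeNbr`; the triangle inequality, symmetry and level comparability of `geo9Y` supplied by name; class multiplicity ≦ m, neighbourhood count ≦ mN and evaluation constant Cev folded into the constants' relations).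
With `C := const37 (exp261 geo9Y δ₀ α) δ₀ α ρ B₀ N N′ C_ℓ K_c`, `δ := (1 − 2α)δ₀` and the datum `E37AllOfOps (W38OfOps (𝔬 x) (rd x)
1 (H x) C δ) (𝔬 x) 1 (H x) C δ (K x) B₁ δ₁ Bβ Bε Bεβ` (p. 409 (3.90) with p. 410's *"convergent in all norms appearing in the
inequalities (3.42)–(3.47)"* READ as Theorem 3.1's typed blocks for the kernel family `K x`): the leaf `B9.Thm37Printed` AND the
leaf `B9.Cor38Printed` hold, given — the static data; Corollary 3.6's blocks for the G′_□ and the structure (3.88) (`h36`), the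
Hölder ∕ V-term ∕ Laplacian ∕ input ∕ two-sided L² legs (`h36H`) at (B₀, δ₀), all POSITED for M ≧ M₁, 0 < α₀,
O(1)Mα₀ ≦ a₁, (3.35); the co-readings of `K x`; the transpose letters; the support counts; the signs; and the relations of the
all-blocks constants (B₁, δ₁, Bβ, Bε, Bεβ) to the derived ones.  [4] Lemma 2.1 ((2.60), (2.61), the size condition), 1 ≦ L ≦ ℓ + 1,
η > 0 and d(a, b) = d(b, a) come from the record (`lemma21Pack_geo9Y`, `geo9Y_dist_symm`); the sup-block leaf from
`thm37_cor38_W38OfOps_exp261_geo9Y`; the rest is `B9RWSumsAllBlocksNbr.thm37Printed_allPin_completeNbr`.  Nothing of print asserted; NOT a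
node discharge. [cite: Balaban1985BackgroundPropagators, Thm 3.7 (3.90) pp.409–410 + Cor. 3.8 (3.94) p.410 + Cor. 3.6 p.408 + (3.42)–(3.47) pp.397–398; Balaban1984PropagatorsII, Lemma 2.1 (2.59)–(2.61) pp.233–234] -/
theorem thm37_cor38_complete_geo9Y_pair {X Y ι PX PY Q : MemberY d ℓ hd hL b₀ b₁ Mstar → Type} [∀ x, Fintype (X x)]
    [∀ x, DecidableEq (X x)] [∀ x, Fintype (Y x)] [∀ x, DecidableEq (Y x)] [∀ x, Fintype (ι x)] [∀ x, Fintype (PX x)]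
    [∀ x, DecidableEq (PX x)] [∀ x, Fintype (PY x)] [∀ x, DecidableEq (PY x)] [∀ x, Fintype (Q x)]
    (𝔬 : ∀ x : MemberY d ℓ hd hL b₀ b₁ Mstar, Ops (geo9Y x) (bg x) (X x) (Y x) (ι x))
    (rd : ∀ x : MemberY d ℓ hd hL b₀ b₁ Mstar, WalkReading (geo9Y x) (bg x) (X x) (ι x))
    (H : MemberY d ℓ hd hL b₀ b₁ Mstar → Prop)
    (𝔭 : ∀ x : MemberY d ℓ hd hL b₀ b₁ Mstar, HolderProbes (geo9Y x) (bg x) (X x) (Y x) (PX x) (PY x))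
    (𝔡 : ∀ x : MemberY d ℓ hd hL b₀ b₁ Mstar, DirOps37 (𝔬 x) (Q x))
    (bH : ∀ x : MemberY d ℓ hd hL b₀ b₁ Mstar, ℝ → BlockNorm (toB6 (geo9Y x) 1 (H x)) (Y x → ℝ))
    (K : ∀ x : MemberY d ℓ hd hL b₀ b₁ Mstar, B9.KernelFamily (geo9Y x) (bg x))
    (ev : ∀ x : MemberY d ℓ hd hL b₀ b₁ Mstar, (geo9Y x).Loc → X x → ℝ)
    (evY : ∀ x : MemberY d ℓ hd hL b₀ b₁ Mstar, (geo9Y x).Loc → Y x → ℝ)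
    (Rel : ∀ x : MemberY d ℓ hd hL b₀ b₁ Mstar, (geo9Y x).Site → (geo9Y x).Site → Prop) [∀ x, DecidableRel (Rel x)] (m : ℕ)
    (Cev : ℝ) (mN : ℕ)
    (hRlen : ∀ x (a a' : (geo9Y x).Site), Rel x a a' → (geo9Y x).len a = (geo9Y x).len a')
    (hRd₁ : ∀ x (a a' b : (geo9Y x).Site), Rel x a a' → (geo9Y x).dist a b = (geo9Y x).dist a' b)
    (hRd₂ : ∀ x (a b b' : (geo9Y x).Site), Rel x b b' → (geo9Y x).dist a b = (geo9Y x).dist a b')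
    (hmult : ∀ x (y' : (geo9Y x).Site), (Finset.univ.filter (fun y'' => Rel x y'' y')).card ≤ m)
    (hnbr : ∀ (x : MemberY d ℓ hd hL b₀ b₁ Mstar) (y : (geo9Y x).Site), (nbr (geo9Y x) 2 y).card ≤ mN) (hCev : 0 ≤ Cev)
    (κ : MemberY d ℓ hd hL b₀ b₁ Mstar → Sizes) (SH S3 SI S2 : ∀ x : MemberY d ℓ hd hL b₀ b₁ Mstar, ι x → Finset (geo9Y x).Site)
    (Bl BV BI θI : ℝ → ℝ) (BI2 : ℝ → ℝ → ℝ)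
    (α ρ N N' Cℓ Kc θ₀ B₀ δ₀ a₁ M₁ αF NH N3 B3 θ3 NQ NI N2 B2 θ2 : ℝ) {B₁ δ₁ : ℝ} {Bβ Bε : ℝ → ℝ} {Bεβ : ℝ → ℝ → ℝ}
    (hc : 0 < c35) (hα : 0 < α) (hα2 : α < 1 / 2) (hN : 0 ≤ N) (hN' : 0 ≤ N') (hCℓ : 1 ≤ Cℓ) (hK : 0 ≤ Kc) (hθ₀ : 0 ≤ θ₀)
    (hB₀ : 0 < B₀) (hδ₀ : 0 < δ₀) (ha₁ : 0 < a₁) (hM₁ : 0 < M₁) (hαF : 0 < αF) (hαF2 : αF ≤ 1 / 2) (hNH : 0 ≤ NH)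
    (hN3 : 0 ≤ N3) (hB3 : 0 ≤ B3) (hθ3 : 0 ≤ θ3) (hNI : 0 ≤ NI) (hN2 : 0 ≤ N2) (hB2 : 0 ≤ B2) (hθ2 : 0 ≤ θ2)
    (hst : ∀ x, StaticOK (𝔬 x) ρ N N' Cℓ (κ x)) (hκ : ∀ x, (κ x).Bounded Kc θ₀ Cℓ (geo9Y x).M)
    (hrd : ∀ x, (rd x).OK (𝔬 x).blk) (hloc : ∀ x, Locality (𝔬 x) (rd x))
    (h36 : ∀ x, M₁ ≤ (geo9Y x).M → ∀ α₀ : ℝ, 0 < α₀ → c35 * (geo9Y x).M * α₀ ≤ a₁ →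
      ∀ U : (bg x).Cfg, (bg x).Reg335 c35 α₀ U → Local342 (𝔬 x) 1 (H x) B₀ δ₀ U ∧ Identities (𝔬 x) 1 (H x) U)
    (h36H : ∀ x, M₁ ≤ (geo9Y x).M → ∀ α₀ : ℝ, 0 < α₀ → c35 * (geo9Y x).M * α₀ ≤ a₁ →
      ∀ U : (bg x).Cfg, (bg x).Reg335 c35 α₀ U →
        HolderLegs37 (𝔬 x) (𝔭 x) 1 (H x) (SH x) Bl δ₀ U ∧ HolderV37 (𝔬 x) (𝔭 x) 1 (H x) BV δ₀ U ∧
          (L2SecondLegs37 (𝔬 x) (𝔡 x) 1 (H x) (S3 x) B3 δ₀ U ∧ FactorsL2Second37 (𝔬 x) (𝔡 x) 1 (H x) θ3 δ₀ U ∧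
            DirTranspose37 (𝔬 x) (𝔡 x) U) ∧
            InputLegs37 (𝔬 x) (𝔭 x) 1 (H x) (bH x) (SI x) BI BI2 δ₀ U ∧ FactorsInput37 (𝔬 x) 1 (H x) (bH x) θI δ₀ U ∧
              L2TwoLegs37 (𝔬 x) 1 (H x) (S2 x) B2 δ₀ U ∧ FactorsL2_37 (𝔬 x) 1 (H x) θ2 δ₀ U)
    (hco0 : ∀ x U, CoRealizesRel (K x) 0 U (Rel x) (𝔬 x).blk (𝔬 x).blk (ev x) ((𝔬 x).Gp U))
    (hco1 : ∀ x U, CoRealizesRel (K x) 1 U (Rel x) (𝔬 x).blkY (𝔬 x).blk (ev x) ((𝔬 x).D U ∘ₗ (𝔬 x).Gp U))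
    (hco2 : ∀ x U, CoRealizesRel (K x) 2 U (Rel x) (𝔬 x).blk (𝔬 x).blkY (evY x) ((𝔬 x).Gp U ∘ₗ (𝔬 x).Dstar U))
    (hco3 : ∀ x U, CoRealizesRel (K x) 3 U (Rel x) (𝔬 x).blk (𝔬 x).blk (ev x) ((𝔬 x).Lap U ∘ₗ (𝔬 x).Gp U))
    (hgl0 : ∀ x U, GlobReads (K x) 0 U (𝔬 x).blk (𝔬 x).blk (ev x) ((𝔬 x).Gp U))
    (hgl1 : ∀ x U, GlobReads (K x) 1 U (𝔬 x).blkY (𝔬 x).blk (ev x) ((𝔬 x).D U ∘ₗ (𝔬 x).Gp U))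
    (hgl2 : ∀ x U, GlobReads (K x) 2 U (𝔬 x).blk (𝔬 x).blkY (evY x) ((𝔬 x).Gp U ∘ₗ (𝔬 x).Dstar U))
    (hgl3 : ∀ x U, GlobReads (K x) 3 U (𝔬 x).blk (𝔬 x).blk (ev x) ((𝔬 x).Lap U ∘ₗ (𝔬 x).Gp U))
    (hl0 : ∀ x U, L2ReadsNbr (R := 1) (H := H x) (K x) 0 U (Rel x) 2 Cev (𝔬 x).blk (𝔬 x).blk (ev x) ((𝔬 x).Gp U))
    (hl1 : ∀ x U, L2ReadsNbr (R := 1) (H := H x) (K x) 1 U (Rel x) 2 Cev (𝔬 x).blkY (𝔬 x).blk (ev x) ((𝔬 x).D U ∘ₗ (𝔬 x).Gp U))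
    (hl2 : ∀ x U, L2ReadsNbr (R := 1) (H := H x) (K x) 2 U (Rel x) 2 Cev (𝔬 x).blk (𝔬 x).blkY (evY x) ((𝔬 x).Gp U ∘ₗ (𝔬 x).Dstar U))
    (hl3 : ∀ x U, L2ReadsNbr (R := 1) (H := H x) (K x) 3 U (Rel x) 2 Cev (𝔬 x).blkY (𝔬 x).blkY (evY x)
      ((𝔬 x).D U ∘ₗ ((𝔬 x).Gp U ∘ₗ (𝔬 x).Dstar U)))
    (hl4 : ∀ x U, L2ReadsNbr (R := 1) (H := H x) (K x) 4 U (Rel x) 2 Cev ((𝔬 x).blk ∘ Prod.fst) (𝔬 x).blk (ev x)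
      (familyOp fun p : Q x × Q x => ((𝔡 x).Dd U p.1 ∘ₗ (𝔡 x).Dd U p.2) ∘ₗ (𝔬 x).Gp U))
    (hl5 : ∀ x U, L2ReadsNbr (R := 1) (H := H x) (K x) 5 U (Rel x) 2 Cev ((𝔬 x).blk ∘ Prod.fst) (𝔬 x).blk (ev x)
      (familyOp fun p : Q x × Q x => (𝔬 x).Gp U ∘ₗ ((𝔡 x).Dsd U p.1 ∘ₗ (𝔡 x).Dsd U p.2)))
    (hH1 : ∀ x U, H1ReadsNbr (K x) U (𝔭 x) (Rel x) 2 (𝔬 x).blk (𝔬 x).blkY (ev x) (evY x) ((𝔬 x).D U ∘ₗ (𝔬 x).Gp U)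
      ((𝔬 x).Gp U ∘ₗ (𝔬 x).Dstar U))
    (hIR : ∀ x U, InputReadsNbr (K x) U (𝔭 x) (bH x) 2 (𝔬 x).blkY (evY x) ((𝔬 x).D U ∘ₗ ((𝔬 x).Gp U ∘ₗ (𝔬 x).Dstar U)))
    (hsym : ∀ x U, IsTransposePair ((𝔬 x).Gp U) ((𝔬 x).Gp U))
    (htr : ∀ x U, IsTransposePair ((𝔬 x).D U ∘ₗ (𝔬 x).Gp U) ((𝔬 x).Gp U ∘ₗ (𝔬 x).Dstar U))
    (hcntH : ∀ x (a : (geo9Y x).Site), (∑ q, if a ∈ SH x q then (1 : ℝ) else 0) ≤ NH)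
    (hcnt3 : ∀ x (a : (geo9Y x).Site), (∑ q, if a ∈ S3 x q then (1 : ℝ) else 0) ≤ N3)
    (hNQ : ∀ x, (Fintype.card (Q x) : ℝ) ≤ NQ)
    (hcntI : ∀ x (a : (geo9Y x).Site), (∑ q, if a ∈ SI x q then (1 : ℝ) else 0) ≤ NI)
    (hcnt2 : ∀ x (a : (geo9Y x).Site), (∑ q, if a ∈ S2 x q then (1 : ℝ) else 0) ≤ N2)
    (hBl : ∀ β, 0 ≤ β → β < 1 → 0 ≤ Bl β) (hBV : ∀ β, 0 ≤ β → β < 1 → 0 ≤ BV β)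
    (hBI : ∀ ε, 0 < ε → ε ≤ 1 → 0 ≤ BI ε) (hBI2 : ∀ ε β, 0 < ε → ε ≤ 1 → 0 ≤ β → β < 1 → 0 ≤ BI2 ε β)
    (hθI : ∀ ε, 0 < ε → 0 ≤ θI ε)
    -- the relations of the all-blocks constants (B₁, δ₁, Bβ, Bε, Bεβ) to the definite derived ones
    (hCB : (m : ℝ) * const37 (exp261 (@geo9Y d ℓ hd hL b₀ b₁ Mstar) δ₀ α) δ₀ α ρ B₀ N N' Cℓ Kc ≤ B₁)
    (hCL : (mN : ℝ) * m * Cev * (((ℓ + 1 : ℕ) : ℝ)) ^ 2 * Real.exp (2 * δ₁) * 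
      (const37 (exp261 (@geo9Y d ℓ hd hL b₀ b₁ Mstar) δ₀ α) δ₀ α ρ B₀ N N' Cℓ Kc * ((ℓ + 1 : ℕ) : ℝ)) ≤ B₁)
    (hδ₁nn : 0 ≤ δ₁) (hδ₁ : δ₁ ≤ (1 - 2 * αF) * ((1 - 2 * α) * δ₀))
    (hCg : const37 (exp261 (@geo9Y d ℓ hd hL b₀ b₁ Mstar) δ₀ α) δ₀ α ρ B₀ N N' Cℓ Kc *
      B6.c1 (exp261 (@geo9Y d ℓ hd hL b₀ b₁ Mstar) ((1 - 2 * α) * δ₀) (1 - αF)) ((1 - 2 * α) * δ₀) (1 - αF) *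
        ((ℓ + 1 : ℕ) : ℝ) ^ (4 : ℝ) ≤ B₁)
    (hB35 : (mN : ℝ) * m * Cev * (((ℓ + 1 : ℕ) : ℝ)) ^ 2 * Real.exp (2 * δ₁) * 
      (NQ * secondConst (exp261 (@geo9Y d ℓ hd hL b₀ b₁ Mstar) δ₀ α) δ₀ α N3 B3 N' θ3
        (const37 (exp261 (@geo9Y d ℓ hd hL b₀ b₁ Mstar) δ₀ α) δ₀ α ρ B₀ N N' Cℓ Kc) ((ℓ + 1 : ℕ) : ℝ)) ≤ B₁)
    (hB4 : (mN : ℝ) * m * Cev * (((ℓ + 1 : ℕ) : ℝ)) ^ 2 * Real.exp (2 * δ₁) * 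
      twoConst (exp261 (@geo9Y d ℓ hd hL b₀ b₁ Mstar) δ₀ α) δ₀ α N2 B2 N' θ2
      (const37 (exp261 (@geo9Y d ℓ hd hL b₀ b₁ Mstar) δ₀ α) δ₀ α ρ B₀ N N' Cℓ Kc) ((ℓ + 1 : ℕ) : ℝ) ≤ B₁)
    (hBβ : ∀ β, 0 ≤ β → β < 1 →
      (m : ℝ) * ((ℓ + 1 : ℕ) : ℝ) * Real.exp (2 * δ₁) * holderConst (exp261 (@geo9Y d ℓ hd hL b₀ b₁ Mstar) δ₀ α) δ₀ α NH N'
        (const37 (exp261 (@geo9Y d ℓ hd hL b₀ b₁ Mstar) δ₀ α) δ₀ α ρ B₀ N N' Cℓ Kc) (Bl β) (BV β) ≤ Bβ β)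
    (hBε : ∀ ε, 0 < ε → ε ≤ 1 →
      Real.exp (2 * δ₁) * inputConst44 (exp261 (@geo9Y d ℓ hd hL b₀ b₁ Mstar) δ₀ α) δ₀ α NI N'
        (const37 (exp261 (@geo9Y d ℓ hd hL b₀ b₁ Mstar) δ₀ α) δ₀ α ρ B₀ N N' Cℓ Kc) ((ℓ + 1 : ℕ) : ℝ) (BI ε) (θI ε) ≤ Bε ε)
    (hBεβ : ∀ ε β, 0 < ε → ε ≤ 1 → 0 ≤ β → β < 1 →
      ((ℓ + 1 : ℕ) : ℝ) * Real.exp (2 * δ₁) * inputConst45 (exp261 (@geo9Y d ℓ hd hL b₀ b₁ Mstar) δ₀ α) δ₀ α NI N' ((ℓ + 1 : ℕ) : ℝ)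
        (holderConst (exp261 (@geo9Y d ℓ hd hL b₀ b₁ Mstar) δ₀ α) δ₀ α NH N'
          (const37 (exp261 (@geo9Y d ℓ hd hL b₀ b₁ Mstar) δ₀ α) δ₀ α ρ B₀ N N' Cℓ Kc) (Bl β) (BV β))
        (BI2 ε β) (θI (β + ε)) ≤ Bεβ ε β) :
    B9.Thm37Printed c35 geo9Y bg
        (fun x => E37AllOfOps
          (W38OfOps (𝔬 x) (rd x) 1 (H x) (const37 (exp261 (@geo9Y d ℓ hd hL b₀ b₁ Mstar) δ₀ α) δ₀ α ρ B₀ N N' Cℓ Kc)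
            ((1 - 2 * α) * δ₀))
          (𝔬 x) 1 (H x) (const37 (exp261 (@geo9Y d ℓ hd hL b₀ b₁ Mstar) δ₀ α) δ₀ α ρ B₀ N N' Cℓ Kc) ((1 - 2 * α) * δ₀)
          (K x) B₁ δ₁ Bβ Bε Bεβ) ∧
      B9.Cor38Printed c35 geo9Y bg
        (fun x => E37AllOfOps
          (W38OfOps (𝔬 x) (rd x) 1 (H x) (const37 (exp261 (@geo9Y d ℓ hd hL b₀ b₁ Mstar) δ₀ α) δ₀ α ρ B₀ N N' Cℓ Kc)
            ((1 - 2 * α) * δ₀))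
          (𝔬 x) 1 (H x) (const37 (exp261 (@geo9Y d ℓ hd hL b₀ b₁ Mstar) δ₀ α) δ₀ α ρ B₀ N N' Cℓ Kc) ((1 - 2 * α) * δ₀)
          (K x) B₁ δ₁ Bβ Bε Bεβ) := by
  obtain ⟨Mth, h261, hfacts, -⟩ :=
    lemma21Pack_geo9Y (d := d) (ℓ := ℓ) (hd := hd) (hL := hL) (b₀ := b₀) (b₁ := b₁) (Mstar := Mstar) H hα hα2 hδ₀ hαF
      (by linarith)
  obtain ⟨h37, hc38⟩ := thm37_cor38_W38OfOps_exp261_geo9Y (bg := bg) 𝔬 rd (fun _ => 1) H κ α ρ N N' Cℓ Kc θ₀ B₀ δ₀ a₁ M₁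
    hc hα hα2.le hN hN' hCℓ hK hθ₀ hB₀ hδ₀ ha₁ hM₁ hst hκ hrd hloc h36
  have hC : 0 ≤ const37 (exp261 (@geo9Y d ℓ hd hL b₀ b₁ Mstar) δ₀ α) δ₀ α ρ B₀ N N' Cℓ Kc :=
    const37_nonneg_of_signs _ hB₀.le hN hN' (zero_le_one.trans hCℓ) hK
  have hδs : 0 < (1 - 2 * α) * δ₀ := mul_pos (by linarith) hδ₀
  refine ⟨?_, (cor38Printed_E37AllOfOps_iff _ 𝔬 (fun _ => 1) H _ _ K B₁ δ₁ Bβ Bε Bεβ).mpr hc38⟩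
  exact thm37Printed_allPin_completePair (geo := geo9Y) (R := fun _ => (1 : ℝ)) 𝔭 𝔡 bH K ev evY Rel m 2 Cev (((ℓ + 1 : ℕ) : ℝ)) mN κ SH Bl BV
    (exp261 (@geo9Y d ℓ hd hL b₀ b₁ Mstar) δ₀ α) δ₀ α ρ N N' Cℓ Kc θ₀ B₀ NH a₁ M₁ Mth S3 N3 B3 θ3 NQ
    SI NI BI θI BI2 S2 N2 B2 θ2 h37 hRlen hRd₁ hRd₂ hmult hnbr one_le_L_nat len_le_of_dist_le_two_geo9Y
    geo9Y_dist_triangle hCev hco0 hco1 hco2 hco3 hgl0 hgl1 hgl2 hgl3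
    hl0 hl1 hl2 hl3 hl4 hl5 hH1 hIR hsym htr hfacts geo9Y_dist_symm hC hCB hCL hδ₁nn (by nlinarith) hδ₁
    (mul_nonneg hαF.le hδs.le) (by nlinarith) hCg hc ha₁ hα.le hα2.le hN' hB₀.le hNH hM₁ hδs.le le_rfl
    hδ₀.le hN3 hB3 hθ3 hNI hN2 hB2 hθ2 hB35 hB4 hst hκ hcntH hcnt3 hNQ hcntI hcnt2 hBl hBV hBI hBI2 hθI hBβ hBε hBεβ h261
    (fun x hM α₀ hα₀ ha U hU => ⟨(h36 x hM α₀ hα₀ ha U hU).1, (h36 x hM α₀ hα₀ ha U hU).2, (h36H x hM α₀ hα₀ ha U hU).1,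
      (h36H x hM α₀ hα₀ ha U hU).2.1⟩)
    (fun x hM α₀ hα₀ ha U hU => (h36H x hM α₀ hα₀ ha U hU).2.2.1)
    (fun x hM α₀ hα₀ ha U hU => ⟨(h36H x hM α₀ hα₀ ha U hU).2.2.2.1, (h36H x hM α₀ hα₀ ha U hU).2.2.2.2.1⟩)
    (fun x hM α₀ hα₀ ha U hU => (h36H x hM α₀ hα₀ ha U hU).2.2.2.2.2)

/-! ## Rows 18 ∕ 19, G side: Theorem 3.10 at the literal all-blocks pin over the geometry of record -/

/-- ★★ **THEOREM 3.10 AT THE LITERAL ALL-BLOCKS PIN OVER def-Y's MEMBERS, FROM OPERATOR-LEVEL INPUTS ONLY, THE (3.43)–(3.46) CO-READINGS SITED ON THE NEIGHBOURHOOD OF RADIUS 2** (the `Nbr` form of `B9RWSumsCompleteGeo9YRel.thm310_complete_geo9Y_rel`, on `B9RWSumsAllBlocksNbr.thm310Printed_allPin_completeNbr`; `geo9Y_dist_triangle`, `geo9Y_dist_symm`, `len_le_of_dist_le_two_geo9Y` by name).  With `C := const37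
(exp261 geo9Y δ₀ α) δ₀ α ρ B₀ N N′ C_ℓ K_c`, `δ := (1 − 2α)δ₀` and the pin `W310OfOps (𝔬 x) (rd x) (ConvAll3107 (𝔬 x) 1 (H x) C δ (K x)
B₁ δ₁ Bβ Bε Bεβ)` (p. 416: *"From (3.108) it follows that the expansion (3.107) is convergent in all norms in the inequalities
(3.42)–(3.47). This implies Theorem 3.3."* READ as Theorem 3.3's typed blocks for `K x`): the leaf `B9.Thm310Printed` holds, given
— the static data (`StaticOK310`, `Sizes310.Bounded`, `WalkReading310.OK`, `Locality310`); Corollary 3.6's blocks for the G_□, (3.89)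
and the structure (3.105) (`h36`), the Hölder ∕ probe-factor ∕ Laplacian ∕ input ∕ two-sided L² legs (`h36H`) at
(B₀, δ₀), all POSITED for M ≧ M₁, 0 < α₀, O(1)Mα₀ ≦ a₁, (3.35); the co-readings of `K x`; the transpose letters; the support
counts; the signs; the relations of (B₁, δ₁, Bβ, Bε, Bεβ) to the derived constants.  [4] Lemma 2.1, 1 ≦ L ≦ ℓ + 1, η > 0 and the
symmetry of d come from the record (`lemma21Pack_geo9Y`, `geo9Y_dist_symm`), the sup-block leaf from `thm310Printed_exp261_geo9Y`,
the rest is `B9RWSumsAllBlocksNbr.thm310Printed_allPin_completeNbr`.  Nothing of print asserted; NOT a node discharge.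
[cite: Balaban1985BackgroundPropagators, Thm 3.10 (3.105)–(3.108) pp.413–416 + Thm 3.3 p.399 + Cor. 3.6 p.408 + (3.42)–(3.47) pp.397–398; Balaban1984PropagatorsII, Lemma 2.1 (2.59)–(2.61) pp.233–234] -/
theorem thm310_complete_geo9Y_pair {X Y ι A PX PY Q : MemberY d ℓ hd hL b₀ b₁ Mstar → Type} [∀ x, Fintype (X x)]
    [∀ x, DecidableEq (X x)] [∀ x, Fintype (Y x)] [∀ x, DecidableEq (Y x)] [∀ x, Fintype (ι x)] [∀ x, Fintype (A x)]
    [∀ x, Fintype (PX x)] [∀ x, DecidableEq (PX x)] [∀ x, Fintype (PY x)] [∀ x, DecidableEq (PY x)] [∀ x, Fintype (Q x)]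
    (𝔬 : ∀ x : MemberY d ℓ hd hL b₀ b₁ Mstar, Ops310 (geo9Y x) (bg x) (X x) (Y x) (ι x) (A x))
    (rd : ∀ x : MemberY d ℓ hd hL b₀ b₁ Mstar, WalkReading310 (geo9Y x) (bg x) (X x) (ι x) (A x))
    (H : MemberY d ℓ hd hL b₀ b₁ Mstar → Prop)
    (𝔭 : ∀ x : MemberY d ℓ hd hL b₀ b₁ Mstar, HolderProbes (geo9Y x) (bg x) (X x) (Y x) (PX x) (PY x))
    (𝔡 : ∀ x : MemberY d ℓ hd hL b₀ b₁ Mstar, DirOps310 (𝔬 x) (Q x))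
    (bH : ∀ x : MemberY d ℓ hd hL b₀ b₁ Mstar, ℝ → BlockNorm (toB6 (geo9Y x) 1 (H x)) (Y x → ℝ))
    (K : ∀ x : MemberY d ℓ hd hL b₀ b₁ Mstar, B9.KernelFamily (geo9Y x) (bg x))
    (ev : ∀ x : MemberY d ℓ hd hL b₀ b₁ Mstar, (geo9Y x).Loc → X x → ℝ)
    (evY : ∀ x : MemberY d ℓ hd hL b₀ b₁ Mstar, (geo9Y x).Loc → Y x → ℝ)
    (Rel : ∀ x : MemberY d ℓ hd hL b₀ b₁ Mstar, (geo9Y x).Site → (geo9Y x).Site → Prop) [∀ x, DecidableRel (Rel x)] (m : ℕ)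
    (Cev : ℝ) (mN : ℕ)
    (hRlen : ∀ x (a a' : (geo9Y x).Site), Rel x a a' → (geo9Y x).len a = (geo9Y x).len a')
    (hRd₁ : ∀ x (a a' b : (geo9Y x).Site), Rel x a a' → (geo9Y x).dist a b = (geo9Y x).dist a' b)
    (hRd₂ : ∀ x (a b b' : (geo9Y x).Site), Rel x b b' → (geo9Y x).dist a b = (geo9Y x).dist a b')
    (hmult : ∀ x (y' : (geo9Y x).Site), (Finset.univ.filter (fun y'' => Rel x y'' y')).card ≤ m)
    (hnbr : ∀ (x : MemberY d ℓ hd hL b₀ b₁ Mstar) (y : (geo9Y x).Site), (nbr (geo9Y x) 2 y).card ≤ mN) (hCev : 0 ≤ Cev)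
    (κ : MemberY d ℓ hd hL b₀ b₁ Mstar → Sizes310)
    (SH S3 SI S2 : ∀ x : MemberY d ℓ hd hL b₀ b₁ Mstar, ι x → Finset (geo9Y x).Site)
    (Bl θH BI θI : ℝ → ℝ) (BI2 : ℝ → ℝ → ℝ)
    (α ρ N N' NF Cℓ Kc θ₀ B₀ δ₀ a₁ M₁ αF NH N3 B3 θ3 NQ NI N2 B2 θ2 : ℝ) {B₁ δ₁ : ℝ} {Bβ Bε : ℝ → ℝ} {Bεβ : ℝ → ℝ → ℝ}
    (hc : 0 < c35) (hα : 0 < α) (hα2 : α < 1 / 2) (hN : 0 ≤ N) (hN' : 0 ≤ N') (hNF : 0 ≤ NF) (hCℓ : 1 ≤ Cℓ) (hK : 0 ≤ Kc)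
    (hθ₀ : 0 ≤ θ₀) (hB₀ : 0 < B₀) (hδ₀ : 0 < δ₀) (ha₁ : 0 < a₁) (hM₁ : 0 < M₁) (hαF : 0 < αF) (hαF2 : αF ≤ 1 / 2)
    (hNH : 0 ≤ NH) (hN3 : 0 ≤ N3) (hB3 : 0 ≤ B3) (hθ3 : 0 ≤ θ3) (hNI : 0 ≤ NI) (hN2 : 0 ≤ N2) (hB2 : 0 ≤ B2) (hθ2 : 0 ≤ θ2)
    (hst : ∀ x, StaticOK310 (𝔬 x) ρ N N' NF Cℓ (κ x)) (hκ : ∀ x, (κ x).Bounded Kc)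
    (hrd : ∀ x, (rd x).OK (𝔬 x).blk) (hloc : ∀ x, Locality310 (𝔬 x) (rd x))
    (h36 : ∀ x, M₁ ≤ (geo9Y x).M → ∀ α₀ : ℝ, 0 < α₀ → c35 * (geo9Y x).M * α₀ ≤ a₁ →
      ∀ U : (bg x).Cfg, (bg x).Reg335 c35 α₀ U →
        Local342G (𝔬 x) 1 (H x) B₀ δ₀ U ∧ B9Thm310Whole.Factors389 (𝔬 x) 1 (H x) θ₀ δ₀ U ∧ Identities310 (𝔬 x) 1 (H x) U)
    (h36H : ∀ x, M₁ ≤ (geo9Y x).M → ∀ α₀ : ℝ, 0 < α₀ → c35 * (geo9Y x).M * α₀ ≤ a₁ →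
      ∀ U : (bg x).Cfg, (bg x).Reg335 c35 α₀ U →
        HolderLegs310 (𝔬 x) (𝔭 x) 1 (H x) (SH x) Bl δ₀ U ∧ FactorsHolder310 (𝔬 x) (𝔭 x) 1 (H x) θH δ₀ U ∧
          (L2SecondLegs310 (𝔬 x) (𝔡 x) 1 (H x) (S3 x) B3 δ₀ U ∧ FactorsL2Second310 (𝔬 x) (𝔡 x) 1 (H x) θ3 δ₀ U ∧
            DirTranspose310 (𝔬 x) (𝔡 x) U) ∧
            InputLegs310 (𝔬 x) (𝔭 x) 1 (H x) (bH x) (SI x) BI BI2 δ₀ U ∧ FactorsInput310 (𝔬 x) 1 (H x) (bH x) θI δ₀ U ∧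
              L2TwoLegs310 (𝔬 x) 1 (H x) (S2 x) B2 δ₀ U ∧ FactorsL2_310 (𝔬 x) 1 (H x) θ2 δ₀ U)
    (hco0 : ∀ x U, CoRealizesRel (K x) 0 U (Rel x) (𝔬 x).blk (𝔬 x).blk (ev x) ((𝔬 x).G U))
    (hco1 : ∀ x U, CoRealizesRel (K x) 1 U (Rel x) (𝔬 x).blkY (𝔬 x).blk (ev x) ((𝔬 x).D U ∘ₗ (𝔬 x).G U))
    (hco2 : ∀ x U, CoRealizesRel (K x) 2 U (Rel x) (𝔬 x).blk (𝔬 x).blkY (evY x) ((𝔬 x).G U ∘ₗ (𝔬 x).Dstar U))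
    (hco3 : ∀ x U, CoRealizesRel (K x) 3 U (Rel x) (𝔬 x).blk (𝔬 x).blk (ev x) ((𝔬 x).Lap U ∘ₗ (𝔬 x).G U))
    (hgl0 : ∀ x U, GlobReads (K x) 0 U (𝔬 x).blk (𝔬 x).blk (ev x) ((𝔬 x).G U))
    (hgl1 : ∀ x U, GlobReads (K x) 1 U (𝔬 x).blkY (𝔬 x).blk (ev x) ((𝔬 x).D U ∘ₗ (𝔬 x).G U))
    (hgl2 : ∀ x U, GlobReads (K x) 2 U (𝔬 x).blk (𝔬 x).blkY (evY x) ((𝔬 x).G U ∘ₗ (𝔬 x).Dstar U))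
    (hgl3 : ∀ x U, GlobReads (K x) 3 U (𝔬 x).blk (𝔬 x).blk (ev x) ((𝔬 x).Lap U ∘ₗ (𝔬 x).G U))
    (hl0 : ∀ x U, L2ReadsNbr (R := 1) (H := H x) (K x) 0 U (Rel x) 2 Cev (𝔬 x).blk (𝔬 x).blk (ev x) ((𝔬 x).G U))
    (hl1 : ∀ x U, L2ReadsNbr (R := 1) (H := H x) (K x) 1 U (Rel x) 2 Cev (𝔬 x).blkY (𝔬 x).blk (ev x) ((𝔬 x).D U ∘ₗ (𝔬 x).G U))
    (hl2 : ∀ x U, L2ReadsNbr (R := 1) (H := H x) (K x) 2 U (Rel x) 2 Cev (𝔬 x).blk (𝔬 x).blkY (evY x) ((𝔬 x).G U ∘ₗ (𝔬 x).Dstar U))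
    (hl3 : ∀ x U, L2ReadsNbr (R := 1) (H := H x) (K x) 3 U (Rel x) 2 Cev (𝔬 x).blkY (𝔬 x).blkY (evY x)
      ((𝔬 x).D U ∘ₗ ((𝔬 x).G U ∘ₗ (𝔬 x).Dstar U)))
    (hl4 : ∀ x U, L2ReadsNbr (R := 1) (H := H x) (K x) 4 U (Rel x) 2 Cev ((𝔬 x).blk ∘ Prod.fst) (𝔬 x).blk (ev x)
      (familyOp fun p : Q x × Q x => ((𝔡 x).Dd U p.1 ∘ₗ (𝔡 x).Dd U p.2) ∘ₗ (𝔬 x).G U))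
    (hl5 : ∀ x U, L2ReadsNbr (R := 1) (H := H x) (K x) 5 U (Rel x) 2 Cev ((𝔬 x).blk ∘ Prod.fst) (𝔬 x).blk (ev x)
      (familyOp fun p : Q x × Q x => (𝔬 x).G U ∘ₗ ((𝔡 x).Dsd U p.1 ∘ₗ (𝔡 x).Dsd U p.2)))
    (hH1 : ∀ x U, H1ReadsNbr (K x) U (𝔭 x) (Rel x) 2 (𝔬 x).blk (𝔬 x).blkY (ev x) (evY x) ((𝔬 x).D U ∘ₗ (𝔬 x).G U)
      ((𝔬 x).G U ∘ₗ (𝔬 x).Dstar U))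
    (hIR : ∀ x U, InputReadsNbr (K x) U (𝔭 x) (bH x) 2 (𝔬 x).blkY (evY x) ((𝔬 x).D U ∘ₗ ((𝔬 x).G U ∘ₗ (𝔬 x).Dstar U)))
    (hsym : ∀ x U, IsTransposePair ((𝔬 x).G U) ((𝔬 x).G U))
    (htr : ∀ x U, IsTransposePair ((𝔬 x).D U ∘ₗ (𝔬 x).G U) ((𝔬 x).G U ∘ₗ (𝔬 x).Dstar U))
    (hcntH : ∀ x (a : (geo9Y x).Site), (∑ q, if a ∈ SH x q then (1 : ℝ) else 0) ≤ NH)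
    (hcnt3 : ∀ x (a : (geo9Y x).Site), (∑ q, if a ∈ S3 x q then (1 : ℝ) else 0) ≤ N3)
    (hNQ : ∀ x, (Fintype.card (Q x) : ℝ) ≤ NQ)
    (hcntI : ∀ x (a : (geo9Y x).Site), (∑ q, if a ∈ SI x q then (1 : ℝ) else 0) ≤ NI)
    (hcnt2 : ∀ x (a : (geo9Y x).Site), (∑ q, if a ∈ S2 x q then (1 : ℝ) else 0) ≤ N2)
    (hBl : ∀ β, 0 ≤ β → β < 1 → 0 ≤ Bl β) (hθH : ∀ β, 0 ≤ β → β < 1 → 0 ≤ θH β)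
    (hBI : ∀ ε, 0 < ε → ε ≤ 1 → 0 ≤ BI ε) (hBI2 : ∀ ε β, 0 < ε → ε ≤ 1 → 0 ≤ β → β < 1 → 0 ≤ BI2 ε β)
    (hθI : ∀ ε, 0 < ε → 0 ≤ θI ε)
    -- the relations of the all-blocks constants (B₁, δ₁, Bβ, Bε, Bεβ) to the definite derived ones
    (hCB : (m : ℝ) * const37 (exp261 (@geo9Y d ℓ hd hL b₀ b₁ Mstar) δ₀ α) δ₀ α ρ B₀ N N' Cℓ Kc ≤ B₁)
    (hCL : (mN : ℝ) * m * Cev * (((ℓ + 1 : ℕ) : ℝ)) ^ 2 * Real.exp (2 * δ₁) * 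
      (const37 (exp261 (@geo9Y d ℓ hd hL b₀ b₁ Mstar) δ₀ α) δ₀ α ρ B₀ N N' Cℓ Kc * ((ℓ + 1 : ℕ) : ℝ)) ≤ B₁)
    (hδ₁nn : 0 ≤ δ₁) (hδ₁ : δ₁ ≤ (1 - 2 * αF) * ((1 - 2 * α) * δ₀))
    (hCg : const37 (exp261 (@geo9Y d ℓ hd hL b₀ b₁ Mstar) δ₀ α) δ₀ α ρ B₀ N N' Cℓ Kc *
      B6.c1 (exp261 (@geo9Y d ℓ hd hL b₀ b₁ Mstar) ((1 - 2 * α) * δ₀) (1 - αF)) ((1 - 2 * α) * δ₀) (1 - αF) *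
        ((ℓ + 1 : ℕ) : ℝ) ^ (4 : ℝ) ≤ B₁)
    (hB35 : (mN : ℝ) * m * Cev * (((ℓ + 1 : ℕ) : ℝ)) ^ 2 * Real.exp (2 * δ₁) * 
      (NQ * secondConst (exp261 (@geo9Y d ℓ hd hL b₀ b₁ Mstar) δ₀ α) δ₀ α N3 B3 NF θ3
        (const37 (exp261 (@geo9Y d ℓ hd hL b₀ b₁ Mstar) δ₀ α) δ₀ α ρ B₀ N N' Cℓ Kc) ((ℓ + 1 : ℕ) : ℝ)) ≤ B₁)
    (hB4 : (mN : ℝ) * m * Cev * (((ℓ + 1 : ℕ) : ℝ)) ^ 2 * Real.exp (2 * δ₁) * 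
      twoConst (exp261 (@geo9Y d ℓ hd hL b₀ b₁ Mstar) δ₀ α) δ₀ α N2 B2 NF θ2
      (const37 (exp261 (@geo9Y d ℓ hd hL b₀ b₁ Mstar) δ₀ α) δ₀ α ρ B₀ N N' Cℓ Kc) ((ℓ + 1 : ℕ) : ℝ) ≤ B₁)
    (hBβ : ∀ β, 0 ≤ β → β < 1 →
      (m : ℝ) * ((ℓ + 1 : ℕ) : ℝ) * Real.exp (2 * δ₁) * holderConst (exp261 (@geo9Y d ℓ hd hL b₀ b₁ Mstar) δ₀ α) δ₀ α NH NF
        (const37 (exp261 (@geo9Y d ℓ hd hL b₀ b₁ Mstar) δ₀ α) δ₀ α ρ B₀ N N' Cℓ Kc) (Bl β) (θH β) ≤ Bβ β)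
    (hBε : ∀ ε, 0 < ε → ε ≤ 1 →
      Real.exp (2 * δ₁) * inputConst44 (exp261 (@geo9Y d ℓ hd hL b₀ b₁ Mstar) δ₀ α) δ₀ α NI NF
        (const37 (exp261 (@geo9Y d ℓ hd hL b₀ b₁ Mstar) δ₀ α) δ₀ α ρ B₀ N N' Cℓ Kc) ((ℓ + 1 : ℕ) : ℝ) (BI ε) (θI ε) ≤ Bε ε)
    (hBεβ : ∀ ε β, 0 < ε → ε ≤ 1 → 0 ≤ β → β < 1 →
      ((ℓ + 1 : ℕ) : ℝ) * Real.exp (2 * δ₁) * inputConst45 (exp261 (@geo9Y d ℓ hd hL b₀ b₁ Mstar) δ₀ α) δ₀ α NI NF ((ℓ + 1 : ℕ) : ℝ)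
        (holderConst (exp261 (@geo9Y d ℓ hd hL b₀ b₁ Mstar) δ₀ α) δ₀ α NH NF
          (const37 (exp261 (@geo9Y d ℓ hd hL b₀ b₁ Mstar) δ₀ α) δ₀ α ρ B₀ N N' Cℓ Kc) (Bl β) (θH β))
        (BI2 ε β) (θI (β + ε)) ≤ Bεβ ε β) :
    B9.Thm310Printed c35 geo9Y bg
      (fun x => W310OfOps (𝔬 x) (rd x)
        (ConvAll3107 (𝔬 x) 1 (H x) (const37 (exp261 (@geo9Y d ℓ hd hL b₀ b₁ Mstar) δ₀ α) δ₀ α ρ B₀ N N' Cℓ Kc)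
          ((1 - 2 * α) * δ₀) (K x) B₁ δ₁ Bβ Bε Bεβ)) := by
  obtain ⟨Mth, h261, hfacts, -⟩ :=
    lemma21Pack_geo9Y (d := d) (ℓ := ℓ) (hd := hd) (hL := hL) (b₀ := b₀) (b₁ := b₁) (Mstar := Mstar) H hα hα2 hδ₀ hαF
      (by linarith)
  have h310 := thm310Printed_exp261_geo9Y (bg := bg) 𝔬 rd (fun _ => 1) H κ α ρ N N' NF Cℓ Kc θ₀ B₀ δ₀ a₁ M₁ hc hα hα2.le hN
    hN' hNF hCℓ hK hθ₀ hB₀ hδ₀ ha₁ hM₁ hst hκ hrd hloc h36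
  have hC : 0 ≤ const37 (exp261 (@geo9Y d ℓ hd hL b₀ b₁ Mstar) δ₀ α) δ₀ α ρ B₀ N N' Cℓ Kc :=
    const37_nonneg_of_signs _ hB₀.le hN hN' (zero_le_one.trans hCℓ) hK
  have hδs : 0 < (1 - 2 * α) * δ₀ := mul_pos (by linarith) hδ₀
  exact thm310Printed_allPin_completePair (geo := geo9Y) (R := fun _ => (1 : ℝ)) 𝔭 𝔡 bH K ev evY Rel m 2 Cev (((ℓ + 1 : ℕ) : ℝ)) mN κ SH Bl θH
    (exp261 (@geo9Y d ℓ hd hL b₀ b₁ Mstar) δ₀ α) δ₀ α ρ N N' NF Cℓ θ₀ NH a₁ M₁ Mth S3 N3 B3 θ3 NQ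
    SI NI BI θI BI2 S2 N2 B2 θ2 h310 hRlen hRd₁ hRd₂ hmult hnbr one_le_L_nat len_le_of_dist_le_two_geo9Y
    geo9Y_dist_triangle hCev hco0 hco1 hco2 hco3 hgl0 hgl1 hgl2 hgl3
    hl0 hl1 hl2 hl3 hl4 hl5 hH1 hIR hsym htr hfacts geo9Y_dist_symm hC hCB hCL hδ₁nn (by nlinarith) hδ₁
    (mul_nonneg hαF.le hδs.le) (by nlinarith) hCg hc ha₁ hα.le hα2.le hNF hθ₀ hNH hδs.le le_rfl hδ₀.le hN3 hB3 hθ3 hNI hN2 hB2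
    hθ2 hB35 hB4 hst hcntH hcnt3 hNQ hcntI hcnt2 hBl hθH hBI hBI2 hθI hBβ hBε hBεβ h261
    (fun x hM α₀ hα₀ ha U hU => ⟨(h36 x hM α₀ hα₀ ha U hU).2.1, (h36 x hM α₀ hα₀ ha U hU).2.2, (h36H x hM α₀ hα₀ ha U hU).1,
      (h36H x hM α₀ hα₀ ha U hU).2.1⟩)
    (fun x hM α₀ hα₀ ha U hU => (h36H x hM α₀ hα₀ ha U hU).2.2.1)
    (fun x hM α₀ hα₀ ha U hU => ⟨(h36H x hM α₀ hα₀ ha U hU).2.2.2.1, (h36H x hM α₀ hα₀ ha U hU).2.2.2.2.1⟩)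
    (fun x hM α₀ hα₀ ha U hU => (h36H x hM α₀ hα₀ ha U hU).2.2.2.2.2)

end

end Literature.MathematicalPhysics.QuantumFieldTheory.Balaban1983to89.B9RWSumsCompleteGeo9YPair
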